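import Summits.QuantumFields.BalabanUV.T4Continuum.Support.VariationalVectorOneG
import Summits.QuantumFields.BalabanUV.T4Continuum.Support.VariationalVectorCentredDiv
import Summits.QuantumFields.BalabanUV.T4Continuum.Support.VariationalVectorCentredFibre

/-!
# T⁴ programme, spine node NE2 (U1a), lane P2 — (ONE-min) WITH BACKGROUND FOR THE COMPONENTWISE CENTRED INTERPOLANT, ASSEMBLED: the `hONEm` socket of the
# vector END from the four kernel pieces (curl half, V-ONE-G, DIV-INTERP, fibre defect) with EXPLICIT raw regularity sizes
# (item «V-ONE-G WITH BACKGROUND», file 5; model level; cell `pub-balaban`)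

NE2 formalisation swarm `b2b-balaban-t4-ne2-formalise-*`, leaf prover 01 GEN 8 (`prover-b2b-balaban-t4-ne2-formalise-leaf-01-g8-0`); journal INTENT
CLAIMS.log 2026-08-20 l.18200 ∕ l.19154 ∕ l.19476.  Files 1–4c of the item BY NAME: `VariationalVectorGaugeSliceDist` (structure + (ONE-min) ⇐ (C)₀ ∧ (G′)),
`VariationalHarmonicApprox` (HARM-APPROX), `VariationalInterpolantSharp`, `VariationalVectorOneG` (V-ONE-G: `oneG_le_add`), `VariationalVectorCentredCurl`
(`SfV_centred_le_socket`), `VariationalVectorCentredDiv` (`divInterp_centred_le`), `VariationalVectorCentredFibre` (`fibreDefect_centred_le`).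

WHAT.
 * §1 **`hONEm_of_pieces`** (abstract in the functionals): a competitor map `J` with (C)₀ `SfV R′ 0 (J W) ≤ (√(ScV R 0 W + E₁ W) + δ′√(qWV W))²`, (G′)
   `c_f·G′(J W) ≤ c_c·G W + E₂ W`, a composite-fibre defect `nsqV(Q_k W − Q_k(Q₁(J W))) ≤ B W`, and the fine V-UB leaf (`Λ`) ⟹ at every coarse field
   `∃ g, Q_k(Q₁ g) = Q_k W₀ ∧ SfV R′ G′ g ≤ (√(ScV R G W₀ + E₁ W₀ + E₂ W₀) + δ′√(qWV W₀) + √(Λ·B W₀))²`; **`hONEm_of_pieces_socket`**: the same folded into the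
   END's two-term shape `(√(ScV R G W₀ + ρ̃ W₀) + δ′√(qWV W₀))²`, `ρ̃ := u·ScV R G W₀ + (1+u)(E₁ + E₂) W₀ + (1+u⁻¹)·Λ·B W₀` (any `u > 0`) — i.e. the `hONEm`
   binder of `VariationalAssemblySliceMin.vector_pair_bracket_sqrt_min_line` ∕ `VariationalVectorEndMonotone.upper_bracket_of_oneMin` with `ε₁ := 1`, `ρ := ρ̃`.
 * §2 **`hONEm_centred`**: §1 AT THE ONE-STEP DATA for `J := J_c` (`(x,ν) ↦ interpv T′ Rc (W(·,ν)) x`), `Q₁ := QvL L (fine n M) (frameT T′ Rc)`, `Q_k := QvL n M T_k`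
   (any contractive coarse line transports), `G := projG Rc (ker Q_T)`, `G′ := projG R′ (ker(Q_T ∘ Q_{T′}))`: (C)₀ DISCHARGED by `SfV_centred_le_socket`
   (`E₁ = (s + (1+s⁻¹)dL∕n²)·(ScV Rc 0 W + ρ_V W)`, `δ′ = √(8d(1+d²))·(nLm₁)`), the fibre defect DISCHARGED by `fibreDefect_centred_le`
   (`B = (25∕4)(n^d)⁻¹Σ‖D_νW_ν‖²`), (G′) taken as the displayed inequality `hG` whose supplier is **`oneG_centred_le`** (= `oneG_le_add` at `V := J_c W` with
   DIV-INTERP `divInterp_centred_le` substituted: `E₂ = t·c_c G W + 3(1+t⁻¹)(c_f·DIV⁺(W) + (d∕4)c_c·Σ‖D(div W − s₀)‖² + C_P e_H·c_c·divSq W)`, `DIV⁺` the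
   explicit bound of file 4b) — so that the consumer writes `hONEm_centred … (oneG_centred_le …)`.
WHAT REMAINS DISPLAYED after this file: the scalar pair's UB⁺∕P⁺∕REG⁺ (inside `e_H`; landed at data classes), the vector fine V-UB `hUBf` (landed at data
classes), and — for the END's summability — V-REG-type control of the raw sizes `ρ_V`, `Σ‖D_νW_ν‖²`, `Σ‖D(div W − s₀)‖²`, `Σ‖D div W‖²`, `divSq`, `hessV` at vector
minimisers with the decaying coefficients `L∕n²`, `(nLm₁)²`, `t`, `s` (the assembler's choice `s_k, t_k, u_k → 0`).

HONEST FRAMING (T4-DAG p. 1).  Composition at MODEL level (frames ∕ bond operators ∕ line transports DATA, c5); [folklore]; nothing printed is a hypothesis;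
no `def`, no `def … : Prop`, no `sorry`; axioms standard.  (ONE-min) with background is hereby a kernel inequality with explicit raw sizes, NOT yet the END's
summable `hONEm_k` (the sizes' V-REG control is displayed); V-END with background ∕ NE2 NOT proved; NE3 OPEN; spine PROVED 0∕9 unchanged; rung (B)+1 on a
fixed finite T⁴ — NOT infinite volume, NOT mass gap, NOT Clay.  HONEST DEPENDENCY (cell, verbatim): continuum YM on T⁴ ⇐ BetaPertH ∧ nine spine estimates
(0/9 proved); BetaPertH ⇐ (D1) ∧ (D4) ∧ CAP+tail; G-an2-4 gates asym, D1 and NE2/3/4.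
-/

noncomputable section

namespace Summit.QuantumFields.BalabanUV.T4Continuum.VariationalVectorOneMinCentred

open Finset WithLp
open Literature.MathematicalPhysics.QuantumFieldTheory.Balaban1983to89
open Literature.MathematicalPhysics.QuantumFieldTheory.Balaban1983to89.B5Prop11Plancherel (Tor fine unitVec)
open Literature.MathematicalPhysics.QuantumFieldTheory.Balaban1983to89.B5Block118 (bpt)
open Summit.QuantumFields.BalabanUV.T4Continuum.VariationalColourFederbush (cDv misv norm_le_one_of_mem_unitary)
open Summit.QuantumFields.BalabanUV.T4Continuum.VariationalColourUpperBound (nsqv)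
open Summit.QuantumFields.BalabanUV.T4Continuum.VariationalColourInterpolant (interpv)
open Summit.QuantumFields.BalabanUV.T4Continuum.VariationalColourOneStepPhys (rhov)
open Summit.QuantumFields.BalabanUV.T4Continuum.VariationalColourScalarPair (Scv Sfv qWv qVv Qkv Q1v)
open Summit.QuantumFields.BalabanUV.T4Continuum.VariationalVectorInterpolant (frameT)
open Summit.QuantumFields.BalabanUV.T4Continuum.VectorBlockTrialForm (QvL nsqV nsqV_nonneg)
open Summit.QuantumFields.BalabanUV.T4Continuum.VariationalVectorForm (curlSq ScV SfV qWV curlSq_nonneg SfV_nonneg qWV_nonneg)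
open Summit.QuantumFields.BalabanUV.T4Continuum.VariationalVectorWeitzenbock (divV divSq)
open Summit.QuantumFields.BalabanUV.T4Continuum.VariationalVectorGaugeSlice (sliceSub projG projG_nonneg avgOp)
open Summit.QuantumFields.BalabanUV.T4Continuum.VariationalVectorGaugeMove (sqrt_projG_add_le)
open Summit.QuantumFields.BalabanUV.T4Continuum.VariationalVectorGaugeSliceDist (sq_sqrt_add_add_le ScV_eq_zero_add SfV_eq_zero_add sqrt_SfV_add_le)
open Summit.QuantumFields.BalabanUV.T4Continuum.VariationalVectorOneStep (hessV)
open Summit.QuantumFields.BalabanUV.T4Continuum.VariationalVectorOneStepPhys (rhoV rhoV_nonneg)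
open Summit.QuantumFields.BalabanUV.T4Continuum.VariationalVectorOneG (oneG_le_add sq_sqrt_add_le_param)
open Summit.QuantumFields.BalabanUV.T4Continuum.VariationalVectorCentredCurl (SfV_centred_le_socket)
open Summit.QuantumFields.BalabanUV.T4Continuum.VariationalVectorCentredDiv (divInterp_centred_le)
open Summit.QuantumFields.BalabanUV.T4Continuum.VariationalVectorCentredFibre (fibreDefect_centred_le)

variable {d : ℕ} {E : Type*} [NormedAddCommGroup E] [InnerProductSpace ℂ E] [CompleteSpace E] [FiniteDimensional ℂ E]
variable (n L : ℕ) [NeZero n] [NeZero L] (M : Fin d → ℕ) [hM : ∀ μ, NeZero (M μ)]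

/-! ## §1 The assembly, abstract in the error functionals -/

section Pieces

omit [InnerProductSpace ℂ E] [CompleteSpace E] [FiniteDimensional ℂ E] in
/-- **(ONE-min)'s COMPETITOR FROM THE FOUR PIECES**: curl half with a root-internal error `E₁`, (G′) with an additive error `E₂`, a composite-fibre defect of
size `B`, the fine V-UB leaf `Λ` ⟹ at every coarse field a competitor in the composite fibre with
`SfV R′ G′ g ≤ (√(ScV R G W₀ + E₁ W₀ + E₂ W₀) + δ′√(qWV W₀) + √(Λ·B W₀))²`. [folklore] -/
theorem hONEm_of_pieces [NormedSpace ℂ E] {R : Tor (fine n M) → Fin d → (E →L[ℂ] E)} {R' : Tor (fine L (fine n M)) → Fin d → (E →L[ℂ] E)}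
    {G : (Tor (fine n M) → Fin d → E) → ℝ} {G' : (Tor (fine L (fine n M)) → Fin d → E) → ℝ} (hG0 : ∀ W, 0 ≤ G W) (hG0' : ∀ V, 0 ≤ G' V)
    (hGadd' : ∀ A B, Real.sqrt (G' (A + B)) ≤ Real.sqrt (G' A) + Real.sqrt (G' B))
    {Qk : (Tor (fine n M) → Fin d → E) → (Tor M → Fin d → E)} {Q₁ : (Tor (fine L (fine n M)) → Fin d → E) → (Tor (fine n M) → Fin d → E)}
    (hQadd : ∀ A B, Qk (Q₁ (A + B)) = Qk (Q₁ A) + Qk (Q₁ B))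
    {J : (Tor (fine n M) → Fin d → E) → (Tor (fine L (fine n M)) → Fin d → E)}
    {E₁ E₂ B : (Tor (fine n M) → Fin d → E) → ℝ} (hE₁ : ∀ W, 0 ≤ E₁ W) (hE₂ : ∀ W, 0 ≤ E₂ W) (_hB : ∀ W, 0 ≤ B W) {δ' Λ : ℝ} (hδ' : 0 ≤ δ') (hΛ : 0 ≤ Λ)
    (hC : ∀ W, SfV n L M R' (fun _ => 0) (J W) ≤ (Real.sqrt (ScV n M R (fun _ => 0) W + E₁ W) + δ' * Real.sqrt (qWV n M W)) ^ 2)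
    (hG : ∀ W, (((n : ℝ) * L) ^ d)⁻¹ * (((n : ℝ) * L) ^ 2 * G' (J W)) ≤ ((n : ℝ) ^ d)⁻¹ * ((n : ℝ) ^ 2 * G W) + E₂ W)
    (hJdef : ∀ W, nsqV M (Qk W - Qk (Q₁ (J W))) ≤ B W)
    (hUBf : ∀ φ : Tor M → Fin d → E, ∃ W', Qk (Q₁ W') = φ ∧ SfV n L M R' G' W' ≤ Λ * nsqV M φ)
    (W₀ : Tor (fine n M) → Fin d → E) :
    ∃ g, Qk (Q₁ g) = Qk W₀ ∧ SfV n L M R' G' g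
      ≤ (Real.sqrt (ScV n M R G W₀ + E₁ W₀ + E₂ W₀) + δ' * Real.sqrt (qWV n M W₀) + Real.sqrt (Λ * B W₀)) ^ 2 := by
  have hn : (0 : ℝ) < n := by exact_mod_cast Nat.pos_of_ne_zero (NeZero.ne n)
  -- the un-repaired competitor
  have hJ : SfV n L M R' G' (J W₀) ≤ (Real.sqrt (ScV n M R G W₀ + E₁ W₀ + E₂ W₀) + δ' * Real.sqrt (qWV n M W₀)) ^ 2 := by
    have ha : 0 ≤ ScV n M R (fun _ => 0) W₀ + E₁ W₀ := by
      have : 0 ≤ ScV n M R (fun _ => 0) W₀ := by have := curlSq_nonneg (fine n M) R W₀; unfold ScV; positivity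
      have := hE₁ W₀; linarith
    have hb : 0 ≤ ((n : ℝ) ^ d)⁻¹ * ((n : ℝ) ^ 2 * G W₀) + E₂ W₀ := by have := hG0 W₀; have := hE₂ W₀; positivity
    rw [SfV_eq_zero_add]
    calc SfV n L M R' (fun _ => 0) (J W₀) + (((n : ℝ) * L) ^ d)⁻¹ * (((n : ℝ) * L) ^ 2 * G' (J W₀))
        ≤ (Real.sqrt (ScV n M R (fun _ => 0) W₀ + E₁ W₀) + δ' * Real.sqrt (qWV n M W₀)) ^ 2 + (((n : ℝ) ^ d)⁻¹ * ((n : ℝ) ^ 2 * G W₀) + E₂ W₀) :=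
          add_le_add (hC W₀) (hG W₀)
      _ ≤ (Real.sqrt (ScV n M R (fun _ => 0) W₀ + E₁ W₀ + (((n : ℝ) ^ d)⁻¹ * ((n : ℝ) ^ 2 * G W₀) + E₂ W₀)) + δ' * Real.sqrt (qWV n M W₀)) ^ 2 :=
          sq_sqrt_add_add_le ha hb (mul_nonneg hδ' (Real.sqrt_nonneg _))
      _ = _ := by rw [ScV_eq_zero_add n M R G W₀]; ring_nf
  -- the repair
  obtain ⟨W', hQW', hSW'⟩ := hUBf (Qk W₀ - Qk (Q₁ (J W₀)))
  refine ⟨J W₀ + W', by rw [hQadd, hQW', add_sub_cancel], ?_⟩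
  have hrep : Real.sqrt (SfV n L M R' G' W') ≤ Real.sqrt (Λ * B W₀) :=
    Real.sqrt_le_sqrt (hSW'.trans (mul_le_mul_of_nonneg_left (hJdef W₀) hΛ))
  have h0 : 0 ≤ Real.sqrt (ScV n M R G W₀ + E₁ W₀ + E₂ W₀) + δ' * Real.sqrt (qWV n M W₀) := by positivity
  have hJ' : Real.sqrt (SfV n L M R' G' (J W₀)) ≤ Real.sqrt (ScV n M R G W₀ + E₁ W₀ + E₂ W₀) + δ' * Real.sqrt (qWV n M W₀) := by
    rw [← Real.sqrt_sq h0]; exact Real.sqrt_le_sqrt hJ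
  have hsum := sqrt_SfV_add_le n L M R' hG0' hGadd' (J W₀) W'
  have hS0 : 0 ≤ SfV n L M R' G' (J W₀ + W') := SfV_nonneg n L M R' hG0' _
  calc SfV n L M R' G' (J W₀ + W') = Real.sqrt (SfV n L M R' G' (J W₀ + W')) ^ 2 := (Real.sq_sqrt hS0).symm
    _ ≤ (Real.sqrt (SfV n L M R' G' (J W₀)) + Real.sqrt (SfV n L M R' G' W')) ^ 2 := pow_le_pow_left₀ (Real.sqrt_nonneg _) hsum 2
    _ ≤ _ := pow_le_pow_left₀ (by positivity) (add_le_add hJ' hrep) 2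

omit [InnerProductSpace ℂ E] [CompleteSpace E] [FiniteDimensional ℂ E] in
/-- **THE SAME IN THE END's TWO-TERM SOCKET SHAPE**: for any `u > 0`,
`SfV R′ G′ g ≤ (√(ScV R G W₀ + ρ̃ W₀) + δ′√(qWV W₀))²`, `ρ̃ W := u·ScV R G W + (1+u)(E₁ W + E₂ W) + (1+u⁻¹)·Λ·B W` — the `hONEm` binder with `ε₁ := 1`,
`ρ := ρ̃` (the composite-fibre identity `Q_k(Q₁ g) = φ` included). [folklore] -/
theorem hONEm_of_pieces_socket [NormedSpace ℂ E] {R : Tor (fine n M) → Fin d → (E →L[ℂ] E)} {R' : Tor (fine L (fine n M)) → Fin d → (E →L[ℂ] E)}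
    {G : (Tor (fine n M) → Fin d → E) → ℝ} {G' : (Tor (fine L (fine n M)) → Fin d → E) → ℝ} (hG0 : ∀ W, 0 ≤ G W) (hG0' : ∀ V, 0 ≤ G' V)
    (hGadd' : ∀ A B, Real.sqrt (G' (A + B)) ≤ Real.sqrt (G' A) + Real.sqrt (G' B))
    {Qk : (Tor (fine n M) → Fin d → E) → (Tor M → Fin d → E)} {Q₁ : (Tor (fine L (fine n M)) → Fin d → E) → (Tor (fine n M) → Fin d → E)}
    (hQadd : ∀ A B, Qk (Q₁ (A + B)) = Qk (Q₁ A) + Qk (Q₁ B))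
    {J : (Tor (fine n M) → Fin d → E) → (Tor (fine L (fine n M)) → Fin d → E)}
    {E₁ E₂ B : (Tor (fine n M) → Fin d → E) → ℝ} (hE₁ : ∀ W, 0 ≤ E₁ W) (hE₂ : ∀ W, 0 ≤ E₂ W) (hB : ∀ W, 0 ≤ B W) {δ' Λ : ℝ} (hδ' : 0 ≤ δ') (hΛ : 0 ≤ Λ)
    (hC : ∀ W, SfV n L M R' (fun _ => 0) (J W) ≤ (Real.sqrt (ScV n M R (fun _ => 0) W + E₁ W) + δ' * Real.sqrt (qWV n M W)) ^ 2)
    (hG : ∀ W, (((n : ℝ) * L) ^ d)⁻¹ * (((n : ℝ) * L) ^ 2 * G' (J W)) ≤ ((n : ℝ) ^ d)⁻¹ * ((n : ℝ) ^ 2 * G W) + E₂ W)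
    (hJdef : ∀ W, nsqV M (Qk W - Qk (Q₁ (J W))) ≤ B W)
    (hUBf : ∀ φ : Tor M → Fin d → E, ∃ W', Qk (Q₁ W') = φ ∧ SfV n L M R' G' W' ≤ Λ * nsqV M φ) {u : ℝ} (hu : 0 < u) :
    ∀ (φ : Tor M → Fin d → E) (W₀ : Tor (fine n M) → Fin d → E), Qk W₀ = φ → (∀ W, Qk W = φ → ScV n M R G W₀ ≤ ScV n M R G W) →
      ∃ g, Qk (Q₁ g) = φ ∧ SfV n L M R' G' g
        ≤ (Real.sqrt (ScV n M R G W₀ + 1 * (u * ScV n M R G W₀ + (1 + u) * (E₁ W₀ + E₂ W₀) + (1 + u⁻¹) * (Λ * B W₀)))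
            + δ' * Real.sqrt (qWV n M W₀)) ^ 2 := by
  intro φ W₀ hW₀ _
  obtain ⟨g, hg, hS⟩ := hONEm_of_pieces n L M hG0 hG0' hGadd' hQadd hE₁ hE₂ hB hδ' hΛ hC hG hJdef hUBf W₀
  refine ⟨g, by rw [hg, hW₀], hS.trans ?_⟩
  set X := ScV n M R G W₀ + E₁ W₀ + E₂ W₀ with hX
  set Y := Λ * B W₀ with hY
  have hX0 : 0 ≤ X := by
    have : 0 ≤ ScV n M R G W₀ := by have := curlSq_nonneg (fine n M) R W₀; have := hG0 W₀; unfold ScV; positivity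
    have := hE₁ W₀; have := hE₂ W₀; positivity
  have hY0 : 0 ≤ Y := by have := hB W₀; positivity
  -- `√X + √Y ≤ √((1+u)X + (1+u⁻¹)Y)`
  have hfold : Real.sqrt X + Real.sqrt Y ≤ Real.sqrt ((1 + u) * X + (1 + u⁻¹) * Y) := by
    have h := sq_sqrt_add_le_param (x := Real.sqrt Y) hX0 hu
    rw [Real.sq_sqrt hY0] at h
    rw [← Real.sqrt_sq (by positivity : 0 ≤ Real.sqrt X + Real.sqrt Y)]
    exact Real.sqrt_le_sqrt h
  have e : (1 + u) * X + (1 + u⁻¹) * Y = ScV n M R G W₀ + 1 * (u * ScV n M R G W₀ + (1 + u) * (E₁ W₀ + E₂ W₀) + (1 + u⁻¹) * (Λ * B W₀)) := by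
    rw [hX, hY]; ring
  rw [← e]
  have h0 : 0 ≤ Real.sqrt X + δ' * Real.sqrt (qWV n M W₀) + Real.sqrt Y := by positivity
  refine pow_le_pow_left₀ h0 ?_ 2
  linarith [hfold]

end Pieces

/-! ## §2 At the one-step data for the componentwise centred interpolant `J_c` -/

section Centred

omit [CompleteSpace E] [FiniteDimensional ℂ E] [NeZero n] [NeZero L] hM in
/-- the composite line average is additive. [folklore] -/
theorem QvL_QvL_add (Tk : Tor M → (Fin d → Fin n) → Fin n → Fin d → (E →L[ℂ] E)) (T1 : Tor (fine n M) → (Fin d → Fin L) → Fin L → Fin d → (E →L[ℂ] E))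
    (A B : Tor (fine L (fine n M)) → Fin d → E) :
    QvL n M Tk (QvL L (fine n M) T1 (A + B)) = QvL n M Tk (QvL L (fine n M) T1 A) + QvL n M Tk (QvL L (fine n M) T1 B) := by
  have h1 : QvL L (fine n M) T1 (A + B) = QvL L (fine n M) T1 A + QvL L (fine n M) T1 B := by
    funext y μ; simp only [QvL, Pi.add_apply, map_add, Finset.sum_add_distrib, smul_add]
  rw [h1]
  funext y μ; simp only [QvL, Pi.add_apply, map_add, Finset.sum_add_distrib, smul_add]

/-- **(G′) FOR `J_c`, EXPLICIT** — `oneG_le_add` at `V := J_c W` with DIV-INTERP (`divInterp_centred_le`) substituted. [folklore] -/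
theorem oneG_centred_le {Rc : Tor (fine n M) → Fin d → (E →L[ℂ] E)} {R' : Tor (fine L (fine n M)) → Fin d → (E →L[ℂ] E)}
    {T : Tor (fine n M) → (E →L[ℂ] E)} {T' : Tor (fine L (fine n M)) → (E →L[ℂ] E)}
    (hT : ∀ x, T x ∈ unitary (E →L[ℂ] E)) (hT' : ∀ x, T' x ∈ unitary (E →L[ℂ] E)) (hRc : ∀ y μ, Rc y μ ∈ unitary (E →L[ℂ] E))
    (hR1 : ∀ x μ, R' x μ ∈ unitary (E →L[ℂ] E))
    {m : ℝ} (hm : 0 ≤ m) (hmis : ∀ y μ j, ‖misv L (fine n M) Rc R' T' y μ j‖ ≤ m)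
    {m₁ : ℝ} (hm₁ : 0 ≤ m₁)
    (hin : ∀ (y : Tor (fine n M)) (j : Fin d → Fin L) (μ : Fin d), (j μ : ℕ) + 1 < L →
      ‖R' (bpt L (fine n M) y j) μ * star (T' (bpt L (fine n M) y j + unitVec (fine L (fine n M)) μ)) - star (T' (bpt L (fine n M) y j))‖ ≤ m₁)
    (hcross : ∀ (y : Tor (fine n M)) (j : Fin d → Fin L) (μ : Fin d), (j μ : ℕ) + 1 = L →
      ‖R' (bpt L (fine n M) y j) μ * star (T' (bpt L (fine n M) y j + unitVec (fine L (fine n M)) μ))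
        - star (T' (bpt L (fine n M) y j)) * Rc y μ‖ ≤ m₁)
    {Λ CP CR : ℝ} (hΛ : 0 ≤ Λ) (hCP : 0 ≤ CP) (hCR : 0 ≤ CR)
    (hUBc : ∀ ψ : Tor M → E, ∃ f, Qkv n M T f = ψ ∧ Scv n M Rc f ≤ Λ * nsqv ψ)
    (hUBf : ∀ ψ : Tor M → E, ∃ g, Qkv n M T (Q1v n L M T' g) = ψ ∧ Sfv n L M R' g ≤ Λ * nsqv ψ)
    (hPc : ∀ f, qWv n M f ≤ CP * (Scv n M Rc f + nsqv (Qkv n M T f)))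
    (hPf : ∀ g, qVv n L M g ≤ CP * (Sfv n L M R' g + nsqv (Qkv n M T (Q1v n L M T' g))))
    (hREG : ∀ (ψ : Tor M → E) f, Qkv n M T f = ψ → (∀ f₂, Qkv n M T f₂ = ψ → Scv n M Rc f ≤ Scv n M Rc f₂) →
      rhov n M Rc f ≤ CR * (Scv n M Rc f + nsqv ψ))
    {t : ℝ} (ht : 0 < t) (W : Tor (fine n M) → Fin d → E) :
    (((n : ℝ) * L) ^ d)⁻¹ * ((n : ℝ) * L) ^ 2
        * projG (fine L (fine n M)) R' (LinearMap.ker ((avgOp n M T).comp (avgOp L (fine n M) T'))) (fun x ν => interpv L (fine n M) T' Rc (fun z => W z ν) x)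
      ≤ ((n : ℝ) ^ d)⁻¹ * (n : ℝ) ^ 2 * projG (fine n M) Rc (LinearMap.ker (avgOp n M T)) W
        + (t * (((n : ℝ) ^ d)⁻¹ * (n : ℝ) ^ 2 * projG (fine n M) Rc (LinearMap.ker (avgOp n M T)) W)
          + 3 * (1 + t⁻¹) * ((((n : ℝ) * L) ^ d)⁻¹ * ((n : ℝ) * L) ^ 2
              * (8 * d * ((L : ℝ) ^ d / (L : ℝ) ^ 2 * hessV (fine n M) Rc W + (1 + m₁) ^ 2 * ((L : ℝ) ^ (d - 1) * ((d : ℝ) / 4 * hessV (fine n M) Rc W))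
                  + m₁ ^ 2 * ((L : ℝ) ^ d / (L : ℝ) ^ 2 * ∑ μ, ∑ y, ‖cDv (fine n M) Rc (fun z => W z μ) y μ‖ ^ 2)
                  + m₁ ^ 2 * (2 * (1 + (d : ℝ) ^ 2) * ((L : ℝ) ^ d * nsqV (fine n M) W)))
                + (d : ℝ) / 2 * ((L : ℝ) ^ d / (L : ℝ) ^ 2 * ∑ y, ∑ κ, ‖cDv (fine n M) Rc (divV (fine n M) Rc W) y κ‖ ^ 2))
            + (Real.sqrt ((d : ℝ) / 4)) ^ 2 * (((n : ℝ) ^ d)⁻¹ * (n : ℝ) ^ 2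
              * ∑ y, ∑ μ, ‖cDv (fine n M) Rc (divV (fine n M) Rc W
                - WithLp.ofLp ((sliceSub (fine n M) Rc (LinearMap.ker (avgOp n M T)))ᗮ.starProjection (toLp 2 (divV (fine n M) Rc W)))) y μ‖ ^ 2)
            + CP * ((((d : ℝ) / 4 + 1 / 2) * ((L : ℝ) / (n : ℝ) ^ 2)) * CR * (Λ + 1)
                + 2 * (Real.sqrt (2 * d * (1 + (d : ℝ) ^ 2)) * ((n : ℝ) * L * m₁))
                  * Real.sqrt ((Λ + (((d : ℝ) / 4 + 1 / 2) * ((L : ℝ) / (n : ℝ) ^ 2)) * CR * (Λ + 1)) * (CP * (Λ + 1)))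
                + (Real.sqrt (2 * d * (1 + (d : ℝ) ^ 2)) * ((n : ℝ) * L * m₁)) ^ 2 * (CP * (Λ + 1))
                + 2 * (Real.sqrt d * ((n : ℝ) * m)) * Real.sqrt (Λ * (CP * (Λ + 1))))
              * (((n : ℝ) ^ d)⁻¹ * (n : ℝ) ^ 2 * divSq (fine n M) Rc W))) := by
  have hn : (0 : ℝ) < n := by exact_mod_cast Nat.pos_of_ne_zero (NeZero.ne n)
  have hL : (0 : ℝ) < L := by exact_mod_cast Nat.pos_of_ne_zero (NeZero.ne L)
  have hR' : ∀ x μ, ‖R' x μ‖ ≤ 1 := fun x μ => norm_le_one_of_mem_unitary (hR1 x μ)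
  have h1 := oneG_le_add n L M hT hT' hRc hR' hm hmis hm₁ hin hcross hΛ hCP hCR hUBc hUBf hPc hPf hREG W
    (fun x ν => interpv L (fine n M) T' Rc (fun z => W z ν) x) ht
  have h2 := divInterp_centred_le L (fine n M) Rc W hT' hR1 hRc hm₁ hin hcross
  dsimp only at h1
  have hcf : 0 ≤ (((n : ℝ) * L) ^ d)⁻¹ * ((n : ℝ) * L) ^ 2 := by positivity
  have hcoef : 0 ≤ 3 * (1 + t⁻¹) := by positivity
  have h3 := mul_le_mul_of_nonneg_left h2 hcf
  have h4 := mul_le_mul_of_nonneg_left h3 hcoef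
  linarith [h1, h4]

/-- **(ONE-min) WITH BACKGROUND FOR `J_c`, ASSEMBLED** (model level; `E` a finite-dimensional Hilbert space; `1 ≤ d`): unitary one-step site frames `T′`, unitary
`Rc`, `R′`; frame defects `≤ m₁`; coarse vector line transports `T_k` contractive; `G := projG Rc (ker Q_T)`, `G′ := projG R′ (ker(Q_T ∘ Q_{T′}))`; the (G′)
inequality `hG` displayed (supplier: `oneG_centred_le`); the vector fine V-UB `hUBf` displayed; any `s, u > 0`.  Conclusion = the `hONEm` binder of the END for
`Q₁ := QvL L (fine n M) (frameT T′ Rc)`, `Q_k := QvL n M T_k`, with `ε₁ := 1` and the explicit `ρ̃`. [folklore] -/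
theorem hONEm_centred (hd : 1 ≤ d) {Rc : Tor (fine n M) → Fin d → (E →L[ℂ] E)} {R' : Tor (fine L (fine n M)) → Fin d → (E →L[ℂ] E)}
    {T : Tor (fine n M) → (E →L[ℂ] E)} {T' : Tor (fine L (fine n M)) → (E →L[ℂ] E)} {Tk : Tor M → (Fin d → Fin n) → Fin n → Fin d → (E →L[ℂ] E)}
    (hT' : ∀ x, T' x ∈ unitary (E →L[ℂ] E)) (hRc : ∀ y μ, Rc y μ ∈ unitary (E →L[ℂ] E)) (hTk : ∀ y j t' μ, ‖Tk y j t' μ‖ ≤ 1)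
    {m₁ : ℝ} (hm₁ : 0 ≤ m₁)
    (hin : ∀ (y : Tor (fine n M)) (j : Fin d → Fin L) (μ : Fin d), (j μ : ℕ) + 1 < L →
      ‖R' (bpt L (fine n M) y j) μ * star (T' (bpt L (fine n M) y j + unitVec (fine L (fine n M)) μ)) - star (T' (bpt L (fine n M) y j))‖ ≤ m₁)
    (hcross : ∀ (y : Tor (fine n M)) (j : Fin d → Fin L) (μ : Fin d), (j μ : ℕ) + 1 = L →
      ‖R' (bpt L (fine n M) y j) μ * star (T' (bpt L (fine n M) y j + unitVec (fine L (fine n M)) μ))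
        - star (T' (bpt L (fine n M) y j)) * Rc y μ‖ ≤ m₁)
    {E₂ : (Tor (fine n M) → Fin d → E) → ℝ} (hE₂ : ∀ W, 0 ≤ E₂ W)
    (hG : ∀ W, (((n : ℝ) * L) ^ d)⁻¹ * (((n : ℝ) * L) ^ 2
        * projG (fine L (fine n M)) R' (LinearMap.ker ((avgOp n M T).comp (avgOp L (fine n M) T'))) (fun x ν => interpv L (fine n M) T' Rc (fun z => W z ν) x))
      ≤ ((n : ℝ) ^ d)⁻¹ * ((n : ℝ) ^ 2 * projG (fine n M) Rc (LinearMap.ker (avgOp n M T)) W) + E₂ W)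
    {Λv : ℝ} (hΛv : 0 ≤ Λv)
    (hUBf : ∀ φ : Tor M → Fin d → E, ∃ W', QvL n M Tk (QvL L (fine n M) (frameT L (fine n M) T' Rc) W') = φ ∧
      SfV n L M R' (projG (fine L (fine n M)) R' (LinearMap.ker ((avgOp n M T).comp (avgOp L (fine n M) T')))) W' ≤ Λv * nsqV M φ)
    {s u : ℝ} (hs : 0 < s) (hu : 0 < u) :
    ∀ (φ : Tor M → Fin d → E) (W₀ : Tor (fine n M) → Fin d → E), QvL n M Tk W₀ = φ →
      (∀ W, QvL n M Tk W = φ → ScV n M Rc (projG (fine n M) Rc (LinearMap.ker (avgOp n M T))) W₀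
        ≤ ScV n M Rc (projG (fine n M) Rc (LinearMap.ker (avgOp n M T))) W) →
      ∃ g, QvL n M Tk (QvL L (fine n M) (frameT L (fine n M) T' Rc) g) = φ ∧
        SfV n L M R' (projG (fine L (fine n M)) R' (LinearMap.ker ((avgOp n M T).comp (avgOp L (fine n M) T')))) g
          ≤ (Real.sqrt (ScV n M Rc (projG (fine n M) Rc (LinearMap.ker (avgOp n M T))) W₀
              + 1 * (u * ScV n M Rc (projG (fine n M) Rc (LinearMap.ker (avgOp n M T))) W₀
                + (1 + u) * ((s + (1 + s⁻¹) * (d * (L : ℝ) / (n : ℝ) ^ 2)) * (ScV n M Rc (fun _ => 0) W₀ + rhoV n M Rc W₀) + E₂ W₀)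
                + (1 + u⁻¹) * (Λv * (25 / 4 * (((n : ℝ) ^ d)⁻¹ * ∑ y, ∑ ν, ‖cDv (fine n M) Rc (fun z => W₀ z ν) y ν‖ ^ 2)))))
            + Real.sqrt (8 * d * (1 + (d : ℝ) ^ 2)) * ((n : ℝ) * L * m₁) * Real.sqrt (qWV n M W₀)) ^ 2 := by
  have hn : (0 : ℝ) < n := by exact_mod_cast Nat.pos_of_ne_zero (NeZero.ne n)
  have hL : (0 : ℝ) < L := by exact_mod_cast Nat.pos_of_ne_zero (NeZero.ne L)
  refine hONEm_of_pieces_socket n L M (R := Rc) (R' := R')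
    (G := projG (fine n M) Rc (LinearMap.ker (avgOp n M T)))
    (G' := projG (fine L (fine n M)) R' (LinearMap.ker ((avgOp n M T).comp (avgOp L (fine n M) T'))))
    (fun W => projG_nonneg _ _ _ W) (fun V => projG_nonneg _ _ _ V) (sqrt_projG_add_le _ R' _)
    (Qk := QvL n M Tk) (Q₁ := QvL L (fine n M) (frameT L (fine n M) T' Rc)) (QvL_QvL_add n L M Tk _)
    (J := fun W => fun x ν => interpv L (fine n M) T' Rc (fun z => W z ν) x)
    (E₁ := fun W => (s + (1 + s⁻¹) * (d * (L : ℝ) / (n : ℝ) ^ 2)) * (ScV n M Rc (fun _ => 0) W + rhoV n M Rc W)) (E₂ := E₂)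
    (B := fun W => 25 / 4 * (((n : ℝ) ^ d)⁻¹ * ∑ y, ∑ ν, ‖cDv (fine n M) Rc (fun z => W z ν) y ν‖ ^ 2))
    (fun W => ?_) hE₂ (fun W => by positivity) (by positivity) hΛv (fun W => ?_) hG (fun W => ?_) hUBf hu
  · have : 0 ≤ ScV n M Rc (fun _ => 0) W := by have := curlSq_nonneg (fine n M) Rc W; unfold ScV; positivity
    have := rhoV_nonneg n M Rc W
    positivity
  · exact SfV_centred_le_socket n L M hd hT' hRc hm₁ hin hcross hs W
  · exact fibreDefect_centred_le n L M hTk hT' hRc W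

end Centred

end Summit.QuantumFields.BalabanUV.T4Continuum.VariationalVectorOneMinCentred

end
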